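import Summits.ResolutionOfSingularities.ResolutionOfSingularities.Theorems.SubmaximalCutRoot
import Summits.ResolutionOfSingularities.ResolutionOfSingularities.Theorems.PowerLiftRoot
import HarnessLib

/-!
# PowerLiftRoot48 — composition of lens-4 g46 «SubmaximalCut» (`noForcedTowers_of_g48`, hSL shed) with lens-5 g42
«PowerLift» (`noForcedTowers_of_g49[h]`, weight axis restricted to the wild weights)

UNCHECKED at writing (2026-09-01T01:10Z): both imports are STAGED, not yet in the tree (writer-1 slices
`Theorems/PowerLift{,Bridge,Transport,Root}.lean` and g46's `Theorems/SubmaximalCutRoot.lean`).  To be `lean check`ed and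
proposed (`--kind proof --supports stmt-ResolutionOfSingularities-30253`) by whoever is seated when BOTH have landed.
Nothing new mathematically: a one-line composition; price 0.  Root consumer of column 30253 after both:
`noForcedTowers_of_g50` — NINE binders `hMo hH hP hM h71 hB hC4 hD4 hNP` with `hP hM h71` wild-only, and
`noForcedTowers_of_g50h` with `hH` wild-only as well (modulo `hMo`).
-/

noncomputable section

set_option linter.dupNamespace false

open Summit.ResolutionOfSingularities.ResolutionOfSingularities.Theorems
open Summit.ResolutionOfSingularities.ResolutionOfSingularities.Theses

namespace Summit.ResolutionOfSingularities.ResolutionOfSingularities.Theorems.HugValuationCut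

/-- **ROOT CONSUMER g50** (g48 ∘ PowerLift §5): nine binders, the structural ports `hP hM` and the contact column `h71`
restricted to the weights divisible by the characteristic. [folklore] -/
theorem noForcedTowers_of_g50 (hMo : MaxContactCut.MonomialCornerAll)
    (hH : MaxContactCut.NoHypersurfaceHuggingTowers) (hP : ShadowPortAtWildWeights)
    (hM : MarkingPortAtWildWeights) (h71 : NoContactHuggingTowersAtWildWeights)
    (hB : NoWildLatentFactorNonThreefoldMixedTowers)
    (hC4 : NoWildOccultDivisorialNonThreefoldMixedTowers) (hD4 : NoWildOccultNonDivisorialNonThreefoldMixedTowers)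
    (hNP : NoContactFreeNonPrincipalInLocusTowers) :
    MaxContactCut.NoForcedTowers :=
  noForcedTowers_of_g48 hMo hH (shadowPortAll_iff_atWildWeights.mpr hP) (markingPortAll_iff_atWildWeights.mpr hM)
    (noContactHuggingTowers_iff_atWildWeights.mpr h71) hB hC4 hD4 hNP

/-- **ROOT CONSUMER g50h**: as `noForcedTowers_of_g50` with the hypersurface-hugging column `hH` ALSO restricted to the
wild weights (the monomial port `hMo` is used twice). [folklore] -/
theorem noForcedTowers_of_g50h (hMo : MaxContactCut.MonomialCornerAll)
    (hH : NoHypersurfaceHuggingTowersAtWildWeights) (hP : ShadowPortAtWildWeights)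
    (hM : MarkingPortAtWildWeights) (h71 : NoContactHuggingTowersAtWildWeights)
    (hB : NoWildLatentFactorNonThreefoldMixedTowers)
    (hC4 : NoWildOccultDivisorialNonThreefoldMixedTowers) (hD4 : NoWildOccultNonDivisorialNonThreefoldMixedTowers)
    (hNP : NoContactFreeNonPrincipalInLocusTowers) :
    MaxContactCut.NoForcedTowers :=
  noForcedTowers_of_g50 hMo ((noHypersurfaceHuggingTowers_iff_atWildWeights hMo).mpr hH) hP hM h71 hB hC4 hD4 hNP

/-- the same from the ABSOLUTE g43 located residual `NoWildOccultNonThreefoldMixedTowers` (eight binders). [folklore] -/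
theorem noForcedTowers_of_g50_residual (hMo : MaxContactCut.MonomialCornerAll)
    (hH : NoHypersurfaceHuggingTowersAtWildWeights) (hP : ShadowPortAtWildWeights)
    (hM : MarkingPortAtWildWeights) (h71 : NoContactHuggingTowersAtWildWeights)
    (hB : NoWildLatentFactorNonThreefoldMixedTowers) (hres : NoWildOccultNonThreefoldMixedTowers)
    (hNP : NoContactFreeNonPrincipalInLocusTowers) :
    MaxContactCut.NoForcedTowers :=
  noForcedTowers_of_g50h hMo hH hP hM h71 hB hres.1 hres.2 hNP

end Summit.ResolutionOfSingularities.ResolutionOfSingularities.Theorems.HugValuationCut
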